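import Literature.IUT.HodgeArakelov.ThetaEvaluationSettingAtModelTate
import Literature.IUT.HodgeArakelov.IotaInvariantThetaInftyHolds
import HarnessLib

/-!
# [IUTchII] Prop 2.2 (ii)′ — the «respectively» (∞θ) clause AT THE [EtTh] MODEL OF RECORD `modelTate p = modelχq p 1 2`, and BOTH
# clauses together: `∃ Θ : IotaInvariantTheta' Dec, Θ.InftyClause` given only (H1), a cyclotome tower and the [IUTchII]-side data
# (proof-only; D-0079 K-L6)

S. Mochizuki, *Inter-universal Teichmüller theory II*, kurims manuscript (Dec. 2020) §2, Prop. 2.2 (ii) p. 66 («… determines a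
specific `μ_{2l}`- (respectively, `μ`-) orbit `θ^ι(Π_v) ⊆ θ(Π_v)` (respectively, `∞θ^ι(Π_v) ⊆ ∞θ(Π_v))`») [claim: Mochizuki2012,
status: disputed] (IUTchII §2 Prop 2.2 (ii), kurims p.66); S. Mochizuki, *The étale theta function …* [EtTh], Publ. RIMS **45**
(2009) (refereed): §1 p. 12 («`Δ_Θ ≅ Ẑ(1)`», compact), Prop. 1.5 (iii) p. 23, Cor. 2.19 (ii) p. 64 (the cyclotome tower)
[cite: MochizukiEtTh2009, Cor 2.19(ii) p.64].

Cell `abc-iut`, seat abc-iut-w5-d072 (gen 4; ι-datum custody lineage of node IUTchII:Prop2.2(ii)); D-0079 programme L-K, K-L6 slice;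
sequel of this seat's `ThetaEvaluationSettingAtModelTate` (p457878/p458562: the μ_{2l}-clause `Prop22_ii' Dec` at the model of
record). PROOF-ONLY companion: NO definition, NO instance, NO new named fact; every input consumed BY NAME — abc-iut-w5-d187's
∞θ-clause closer `EtaleThetaDataOfSetting.inftyClause_of_cyclotomeTower_of_prop15iii` (`IotaInvariantThetaInftyHolds`, hfix/hdiv
discharged), abc-iut-L2-t8's `isCompact_deltaTheta_modelχq`, abc-iut-L2-t5's `CurveTheta.t2Space_GTheta`, `modelχq_isEtThOrigin`,
abc-iut-L2-t6's `prop15iii_etaleThetaDataOfClass_etaDdχq`; nothing landed is edited or restated. NOTE: abc-iut-w5-d187's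
origin-route closer `inftyClause_of_origins_of_prop15iii` (binder `IsThm16Origin`) does NOT apply here — the stage-2 model is
NOT a Thm. 1.6 origin (abc-iut-L2-t5's `not_isThm16Origin_modelχq`) — so the cyclotome tower stays a DATA binder (inhabited:
abc-iut-L2-t8's `modelχq_nonempty_cyclotomeTower`).

THIS FILE.
* `inftyClause_modelχq` — at `modelχq p i j` (every `i`, even `j`), for EVERY étale-theta datum `E`, every `X̲̲`-choice `C`, every
  cyclotome tower `τ` and every `IotaInvariantTheta'` datum `Θ` over the L6 model `etaleThetaDataOfSetting' C …`: `Θ.InftyClause`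
  (`∞θ^ι(Π_v) ≠ ∅`, one `μ`-orbit within each `{(l·ℤ) × μ}`-orbit, meets every root level) — abc-iut-w5-d187's closer with the guard
  `IsEtThOrigin` (F-2498), «`Δ_Θ` compact» and «`(Π^tp_X)^Θ` Hausdorff» THEOREMS at the model; residual `h15`, (H1), `τ`, data;
* `inftyClause_modelTate` — at the Tate instance, section datum of ANY continuous Galois section: `h15` = [EtTh] Prop. 1.5 (iii)
  (F-0591) is abc-iut-L2-t6's theorem; residual {(H1) F-2633 at the instance, `τ` (DATA), [IUTchII]-side data, `Θ`};
* **`exists_iotaInvariantTheta'_inftyClause_modelTate`** — BOTH clauses of IUTchII:Prop2.2(ii)′ at the model of record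
  (`s := inr`, `X̲̲` of record): `∃ Θ : IotaInvariantTheta' Dec, Θ.InftyClause` for EVERY [IUTchII]-side datum `(S, eS, hl, T₀, Dec)`
  and EVERY cyclotome tower `τ`, GIVEN ONLY (H1) `PiYddCharacteristic C` — the μ_{2l}-clause witness is this seat's
  `prop22_ii'_modelTate` (p457878: every ι-datum / class-level / §1-fact binder a theorem), the ∞θ-clause is `inftyClause_modelTate`.
RESIDUAL OF RECORD for NODES IUTchII:Prop2.2(ii) (both clauses) at the model of record: {(H1) F-2633 at the instance (ROUTE A ⟸
F-0620, `prop22_ii'_modelTate_of_cor218_i` p458562 / abc-iut-L6-d6's row), a cyclotome tower `τ` (DATA), the [IUTchII]-side DATA}.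

HONEST LABEL. `modelχq` / `modelTate` is a SEMI-SYNTHETIC model of the typed [EtTh] §1 interface (not the tempered `π₁` of a
curve, no theta FUNCTION): binder-discharge / joint-satisfiability evidence only. The [IUTchII] claim key `Mochizuki2012` is
DISPUTED (D-0012) and nothing of it is asserted; nothing of [EtTh] is asserted; no side is taken on [IUTchIII] Cor. 3.12; typed ≠
proved; instantiated ≠ endorsed; nothing here bears on whether abc is proved or refuted. bears_on: LADDER-ABC:A2.L-K (K-L6,
IUTchII:Prop2.2(ii) both clauses, instance form) → rung 0 `Summit.ABC`.
-/

noncomputable section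

open Literature.AnabelianGeometry.EtaleTheta (ContH1 ThetaSetting)
open Literature.AnabelianGeometry.EtaleTheta
open _root_.Topology

namespace Literature.AnabelianGeometry.EtaleTheta.SettingModel

open Literature.IUT.HodgeArakelov Literature.IUT.HodgeArakelov.EtaleThetaDataOfSetting
open Literature.AnabelianGeometry.SemiGraphs

variable (p : ℕ) [Fact p.Prime] (i j : ℤ) (hj : Even j)

/-- **The «respectively» (∞θ) clause of IUTchII:Prop2.2(ii)′ AT THE STAGE-2 MODEL** `modelχq p i j`: for every étale-theta datum
`E`, every `X̲̲`-choice `C`, every cyclotome tower `τ` and every `IotaInvariantTheta'` datum `Θ` over `etaleThetaDataOfSetting' C …`,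
`Θ.InftyClause` — abc-iut-w5-d187's `inftyClause_of_cyclotomeTower_of_prop15iii` with `IsEtThOrigin` (`modelχq_isEtThOrigin`),
«`Δ_Θ` compact» (`isCompact_deltaTheta_modelχq`) and «`(Π^tp_X)^Θ` Hausdorff» (`CurveTheta.t2Space_GTheta`) SUPPLIED.
Residual: `h15` [EtTh] Prop. 1.5 (iii) for `E`, (H1), the tower, the [IUTchII]-side data. [claim: Mochizuki2012, status: disputed]
(IUTchII §2 Prop 2.2 (ii), kurims p.66) -/
theorem inftyClause_modelχq (E : (ThetaSetting.modelχq p i j hj).EtaleThetaData) {l : ℕ} (C : E.DoubleUnderline l)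
    {Es : Set ℕ+} (τ : (ThetaSetting.modelχq p i j hj).CyclotomeTower l Es)
    (h15 : ThetaSetting.Prop15iii E (compat_modelχq p i j hj)) (hchar : PiYddCharacteristic C)
    (S : BadPlaceSetting.{0}) (eS : (Pi C) ≃ₜ* S.PiX) (hl : S.l = l) {T₀ : TemperedCoverings S (Pi C)}
    {Dec : SubgraphDecomposition S T₀ (etaleThetaDataOfSetting' C (compat_modelχq p i j hj)
      (ThetaSetting.modelχq_sec2Hyps p i j hj) hchar S.toThetaSetting eS hl)}
    (Θ : IotaInvariantTheta' Dec) : Θ.InftyClause := by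
  haveI : T2Space (ThetaSetting.modelχq p i j hj).GtpTheta := CurveTheta.t2Space_GTheta (curveχq p i j)
  exact inftyClause_of_cyclotomeTower_of_prop15iii C (ThetaSetting.modelχq_isEtThOrigin p i j hj) τ
    (isCompact_deltaTheta_modelχq p i j hj) (compat_modelχq p i j hj) (ThetaSetting.modelχq_sec2Hyps p i j hj) h15 hchar S eS hl Θ

/-! ### The Tate instance: [EtTh] Prop. 1.5 (iii) DISCHARGED at the section data; BOTH clauses at the `X̲̲` of record -/

section TateSection

variable (s : GQp p →* (ThetaSetting.modelTate p).PiTemp) (hs : Continuous s)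
  (hsec : ∀ σ : GQp p, (ThetaSetting.modelTate p).aug (s σ) = σ)
  (hsY : (ThetaSetting.modelTate p).GK.map s ≤ (ThetaSetting.modelTate p).GtpY)
  (hsYdd : (ThetaSetting.modelTate p).GKdd.map s ≤ (ThetaSetting.modelTate p).GtpYdd)

/-- **The ∞θ clause AT THE TATE INSTANCE, section datum `E_s` of ANY continuous Galois section** (class of record `η̈♯`):
`inftyClause_modelχq` with `h15 :=` abc-iut-L2-t6's `prop15iii_etaleThetaDataOfClass_etaDdχq`. Residual: (H1), the tower `τ`
(DATA), the [IUTchII]-side data, `Θ`. [claim: Mochizuki2012, status: disputed] (IUTchII §2 Prop 2.2 (ii), kurims p.66) -/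
theorem inftyClause_modelTate {l : ℕ}
    (C : (((kummerCoreχq p 1 2 even_two).toKummerDataOfSection s hs hsec hsY hsYdd).etaleThetaDataOfClass
      (etaDdχq p 1 2 even_two)).DoubleUnderline l)
    {Es : Set ℕ+} (τ : (ThetaSetting.modelTate p).CyclotomeTower l Es) (hchar : PiYddCharacteristic C)
    (S : BadPlaceSetting.{0}) (eS : (Pi C) ≃ₜ* S.PiX) (hl : S.l = l) {T₀ : TemperedCoverings S (Pi C)}
    {Dec : SubgraphDecomposition S T₀ (etaleThetaDataOfSetting' C (compat_modelχq p 1 2 even_two)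
      (ThetaSetting.modelχq_sec2Hyps p 1 2 even_two) hchar S.toThetaSetting eS hl)}
    (Θ : IotaInvariantTheta' Dec) : Θ.InftyClause :=
  inftyClause_modelχq p 1 2 even_two _ C τ
    (prop15iii_etaleThetaDataOfClass_etaDdχq p (compat_modelχq p 1 2 even_two) s hs hsec hsY hsYdd) hchar S eS hl Θ

end TateSection

/-- **BOTH clauses of IUTchII:Prop2.2(ii)′ AT THE [EtTh] MODEL OF RECORD** (`modelTate p`, Galois factor `inr`, class `η̈♯`, `X̲̲` of
record): for every odd `l`, every cyclotome tower `τ` and EVERY [IUTchII]-side datum `(S, eS, hl, T₀, Dec)`, GIVEN ONLY (H1)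
`PiYddCharacteristic C` (F-2633 at the instance): `∃ Θ : IotaInvariantTheta' Dec, Θ.InftyClause` — the μ_{2l}-clause witness from this
seat's `prop22_ii'_modelTate` (every ι-datum / class-level / §1-fact binder a theorem there) and the ∞θ clause from
`inftyClause_modelTate`. [claim: Mochizuki2012, status: disputed] (IUTchII §2 Prop 2.2 (ii), kurims p.66) -/
theorem exists_iotaInvariantTheta'_inftyClause_modelTate (l : ℕ+) (hlo : Odd (l : ℕ)) {Es : Set ℕ+}
    (τ : (ThetaSetting.modelTate p).CyclotomeTower l Es)
    (hchar : PiYddCharacteristic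
      ((((kummerCoreχq p 1 2 even_two).toKummerDataOfSection SemidirectProduct.inr (continuous_inrχq p 1 2)
        (fun _ => rfl) (map_inr_GK_le_GtpY_modelχq' p 1 2 even_two)
        (map_inr_GKdd_le_GtpYdd_modelχq' p 1 2 even_two)).etaleThetaDataOfClass
        (etaDdχq p 1 2 even_two)).doubleUnderlineχqOfEtaRes p 1 2 l hlo (eta_res_etaDdχq p 1 2 even_two l hlo)))
    (S : BadPlaceSetting.{0})
    (eS : (Pi ((((kummerCoreχq p 1 2 even_two).toKummerDataOfSection SemidirectProduct.inr (continuous_inrχq p 1 2)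
        (fun _ => rfl) (map_inr_GK_le_GtpY_modelχq' p 1 2 even_two)
        (map_inr_GKdd_le_GtpYdd_modelχq' p 1 2 even_two)).etaleThetaDataOfClass
        (etaDdχq p 1 2 even_two)).doubleUnderlineχqOfEtaRes p 1 2 l hlo (eta_res_etaDdχq p 1 2 even_two l hlo))) ≃ₜ*
      S.PiX)
    (hl : S.l = l)
    {T₀ : TemperedCoverings S (Pi ((((kummerCoreχq p 1 2 even_two).toKummerDataOfSection SemidirectProduct.inr
        (continuous_inrχq p 1 2) (fun _ => rfl) (map_inr_GK_le_GtpY_modelχq' p 1 2 even_two)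
        (map_inr_GKdd_le_GtpYdd_modelχq' p 1 2 even_two)).etaleThetaDataOfClass
        (etaDdχq p 1 2 even_two)).doubleUnderlineχqOfEtaRes p 1 2 l hlo (eta_res_etaDdχq p 1 2 even_two l hlo)))}
    (Dec : SubgraphDecomposition S T₀ (etaleThetaDataOfSetting'
      ((((kummerCoreχq p 1 2 even_two).toKummerDataOfSection SemidirectProduct.inr (continuous_inrχq p 1 2)
        (fun _ => rfl) (map_inr_GK_le_GtpY_modelχq' p 1 2 even_two)
        (map_inr_GKdd_le_GtpYdd_modelχq' p 1 2 even_two)).etaleThetaDataOfClass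
        (etaDdχq p 1 2 even_two)).doubleUnderlineχqOfEtaRes p 1 2 l hlo (eta_res_etaDdχq p 1 2 even_two l hlo))
      (compat_modelχq p 1 2 even_two) (ThetaSetting.modelχq_sec2Hyps p 1 2 even_two) hchar S.toThetaSetting eS hl)) :
    ∃ Θ : IotaInvariantTheta' Dec, Θ.InftyClause := by
  obtain ⟨Θ⟩ := prop22_ii'_modelTate p l hlo hchar S eS hl Dec
  exact ⟨Θ, inftyClause_modelTate p SemidirectProduct.inr (continuous_inrχq p 1 2) (fun _ => rfl)
    (map_inr_GK_le_GtpY_modelχq' p 1 2 even_two) (map_inr_GKdd_le_GtpYdd_modelχq' p 1 2 even_two) _ τ hchar S eS hl Θ⟩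

end Literature.AnabelianGeometry.EtaleTheta.SettingModel

end
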